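import Literature.Analysis.FluidPDE.StretchedLayerSliceCalculus
import HarnessLib

/-!
# Shift differences `f(x + ℓ, y) − f(x, y)` of curried plane fields

Analysis/FluidPDE support file (everything proved, no definitions, no named facts), continuing
`StretchedLayerSliceCalculus`: regularity and slice derivatives (`∂ₓ`, `∂_y`, `∂ₓ∂ₓ`, `∂_y∂_y`,
`Δ` of `StretchedLayerNS`) of the `x`-translate `f(x + ℓ, y)` and of the **shift difference**
`f(x + ℓ, y) − f(x, y)` of a `C¹`/`C²` plane field, the decay of the shift difference across the
layer from the decay of `∂ₓf` (fundamental theorem of calculus in `x`: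
`|f(x + ℓ, y) − f(x, y)| ≤ Cℓ e^{−k|y|}` when `|∂ₓf| ≤ Ce^{−k|y|}`), and the unpacking of the
energy-class bounds of a time slice into strain bounds. Used by `StretchedLayerShiftSystem`
(the shift difference of a solution of the stretched layer system solves the linearised system)
and `StretchedLayerEnergyRigidity`. All statements are folklore calculus.
-/

noncomputable section

open Set Function Filter
open scoped Topology

namespace Literature.Analysis.FluidPDE

namespace StretchedLayer

/-! ### Translates and shift differences of plane fields -/

/-- The `x`-translate of a `Cⁿ` plane field is `Cⁿ`. [folklore] -/
theorem contDiff_translate {f : ℝ → ℝ → ℝ} {n : WithTop ℕ∞}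
    (hf : ContDiff ℝ n (fun q : ℝ × ℝ => f q.1 q.2)) (ℓ : ℝ) :
    ContDiff ℝ n (fun q : ℝ × ℝ => f (q.1 + ℓ) q.2) :=
  hf.comp ((contDiff_fst.add contDiff_const).prodMk contDiff_snd)

/-- The shift difference `f(x + ℓ, y) − f(x, y)` of a `Cⁿ` plane field is `Cⁿ`. [folklore] -/
theorem contDiff_shiftSub {f : ℝ → ℝ → ℝ} {n : WithTop ℕ∞}
    (hf : ContDiff ℝ n (fun q : ℝ × ℝ => f q.1 q.2)) (ℓ : ℝ) :
    ContDiff ℝ n (fun q : ℝ × ℝ => f (q.1 + ℓ) q.2 - f q.1 q.2) :=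
  (contDiff_translate hf ℓ).sub hf

/-- `∂ₓ` of the shift difference of a `Cⁿ` field, `n ≠ 0`. [folklore] -/
theorem dX_shiftSub {f : ℝ → ℝ → ℝ} {n : WithTop ℕ∞}
    (hf : ContDiff ℝ n (fun q : ℝ × ℝ => f q.1 q.2)) (hn : n ≠ 0) (ℓ x y : ℝ) :
    dX (fun r s => f (r + ℓ) s - f r s) x y = dX f (x + ℓ) y - dX f x y := by
  rw [dX_sub (hasDerivAt_dX_of_contDiff (contDiff_translate hf ℓ) hn x y).differentiableAt
    (hasDerivAt_dX_of_contDiff hf hn x y).differentiableAt, dX_translate]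

/-- `∂_y` of the shift difference of a `Cⁿ` field, `n ≠ 0`. [folklore] -/
theorem dY_shiftSub {f : ℝ → ℝ → ℝ} {n : WithTop ℕ∞}
    (hf : ContDiff ℝ n (fun q : ℝ × ℝ => f q.1 q.2)) (hn : n ≠ 0) (ℓ x y : ℝ) :
    dY (fun r s => f (r + ℓ) s - f r s) x y = dY f (x + ℓ) y - dY f x y := by
  rw [dY_sub (hasDerivAt_dY_of_contDiff (contDiff_translate hf ℓ) hn x y).differentiableAt
    (hasDerivAt_dY_of_contDiff hf hn x y).differentiableAt, dY_translate]

/-- `∂ₓ` of the shift difference, as functions. [folklore] -/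
theorem dX_shiftSub_fun {f : ℝ → ℝ → ℝ} {n : WithTop ℕ∞}
    (hf : ContDiff ℝ n (fun q : ℝ × ℝ => f q.1 q.2)) (hn : n ≠ 0) (ℓ : ℝ) :
    dX (fun r s => f (r + ℓ) s - f r s) = fun x y => dX f (x + ℓ) y - dX f x y :=
  funext fun x => funext fun y => dX_shiftSub hf hn ℓ x y

/-- `∂_y` of the shift difference, as functions. [folklore] -/
theorem dY_shiftSub_fun {f : ℝ → ℝ → ℝ} {n : WithTop ℕ∞}
    (hf : ContDiff ℝ n (fun q : ℝ × ℝ => f q.1 q.2)) (hn : n ≠ 0) (ℓ : ℝ) :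
    dY (fun r s => f (r + ℓ) s - f r s) = fun x y => dY f (x + ℓ) y - dY f x y :=
  funext fun x => funext fun y => dY_shiftSub hf hn ℓ x y

/-- `∂ₓ∂ₓ` of the shift difference of a `C²` field. [folklore] -/
theorem dXdX_shiftSub {f : ℝ → ℝ → ℝ} (hf : ContDiff ℝ 2 (fun q : ℝ × ℝ => f q.1 q.2))
    (ℓ x y : ℝ) :
    dX (dX (fun r s => f (r + ℓ) s - f r s)) x y = dX (dX f) (x + ℓ) y - dX (dX f) x y := by
  rw [dX_shiftSub_fun hf two_ne_zero]
  exact dX_shiftSub (contDiff_one_dX hf) one_ne_zero ℓ x y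

/-- `∂_y∂_y` of the shift difference of a `C²` field. [folklore] -/
theorem dYdY_shiftSub {f : ℝ → ℝ → ℝ} (hf : ContDiff ℝ 2 (fun q : ℝ × ℝ => f q.1 q.2))
    (ℓ x y : ℝ) :
    dY (dY (fun r s => f (r + ℓ) s - f r s)) x y = dY (dY f) (x + ℓ) y - dY (dY f) x y := by
  rw [dY_shiftSub_fun hf two_ne_zero]
  exact dY_shiftSub (contDiff_one_dY hf) one_ne_zero ℓ x y

/-- `Δ` of the shift difference of a `C²` field. [folklore] -/
theorem lap_shiftSub {f : ℝ → ℝ → ℝ} (hf : ContDiff ℝ 2 (fun q : ℝ × ℝ => f q.1 q.2))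
    (ℓ x y : ℝ) :
    lap (fun r s => f (r + ℓ) s - f r s) x y = lap f (x + ℓ) y - lap f x y := by
  simp only [lap_apply, dXdX_shiftSub hf, dYdY_shiftSub hf]
  ring

/-- **Decay of the shift difference across the layer**: if `|∂ₓf(s, y)| ≤ C e^{−k|y|}` for all `s`
(`f` a `Cⁿ` field, `n ≠ 0`, `ℓ ≥ 0`) then `|f(x + ℓ, y) − f(x, y)| ≤ Cℓ e^{−k|y|}`. [folklore] -/
theorem abs_shiftSub_le {f : ℝ → ℝ → ℝ} {n : WithTop ℕ∞}
    (hf : ContDiff ℝ n (fun q : ℝ × ℝ => f q.1 q.2)) (hn : n ≠ 0) {C k ℓ : ℝ} (hℓ : 0 ≤ ℓ)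
    (hC : ∀ x y, |dX f x y| ≤ C * Real.exp (-k * |y|)) (x y : ℝ) :
    |f (x + ℓ) y - f x y| ≤ C * ℓ * Real.exp (-k * |y|) := by
  have h := abs_sub_shift_le (f := fun s => f s y)
    (fun s => (hasDerivAt_dX_of_contDiff hf hn s y).differentiableAt) hℓ (fun s => hC s y) x
  calc |f (x + ℓ) y - f x y| ≤ C * Real.exp (-k * |y|) * ℓ := h
    _ = C * ℓ * Real.exp (-k * |y|) := by ring

/-! ### Energy-class bounds of a time slice -/

/-- The strain bounds `|∂ₓu|, |∂_yu|, |∂ₓv|, |∂_yv| ≤ C` at time `t` from the energy-class bounds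
(the exponential weight is `≤ 1`). [folklore] -/
theorem strain_bounds_of_bounds {u v : ℝ → ℝ → ℝ → ℝ} {t C k : ℝ} (hk : 0 < k)
    (hb1 : ∀ x y, |u t x y| + |v t x y| + |dY (u t) x y| + |dY (v t) x y| ≤ C)
    (hb2 : ∀ x y, |dX (u t) x y| + |dX (v t) x y| ≤ C * Real.exp (-k * |y|)) (x y : ℝ) :
    |dX (u t) x y| ≤ C ∧ |dY (u t) x y| ≤ C ∧ |dX (v t) x y| ≤ C ∧ |dY (v t) x y| ≤ C := by
  have hC0 : 0 ≤ C := le_trans (by positivity) (hb1 0 0)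
  have he1 : Real.exp (-k * |y|) ≤ 1 := Real.exp_le_one_iff.2 (by nlinarith [abs_nonneg y, hk])
  have h2 : |dX (u t) x y| + |dX (v t) x y| ≤ C := (hb2 x y).trans (mul_le_of_le_one_right hC0 he1)
  have h1 := hb1 x y
  refine ⟨?_, ?_, ?_, ?_⟩
  · linarith [abs_nonneg (dX (v t) x y)]
  · linarith [abs_nonneg (u t x y), abs_nonneg (v t x y), abs_nonneg (dY (v t) x y)]
  · linarith [abs_nonneg (dX (u t) x y)]
  · linarith [abs_nonneg (u t x y), abs_nonneg (v t x y), abs_nonneg (dY (u t) x y)]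

end StretchedLayer

end Literature.Analysis.FluidPDE
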